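import Mathlib.Tactic.Linarith
import Mathlib.Tactic.NormNum
import Summits.Ventures.CertifiedManyBodySolver.Downfold.PhaseMapCellScore

/-!
# The MATERIAL VERDICT of the material-oracle acceptance test (ACCEPTANCE §4.5) as a total function,
# with the FP-guard, honest-abstention and «an FN is visible at cell level» theorems

Venture CertifiedManyBodySolver, cell `pub/hubbard-downfold`, seat hubbard-downfold-score-1 (second scoring
engine); namespace `Summit.Ventures.CertifiedManyBodySolver.Downfold.CellScore` (continues
`PhaseMapCellScore.lean`: `Word`, `Truth`, `truthSC`, `outcome`). LEVEL 4 of the acceptance test (D-0098 verbatim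
«correctly differentiate between all known superconductor claims»). Everything here is PROVED.

WHAT THIS IS NOT: not a statement about any material and not the scorer of record (`deputy-2/score.py` v1.3 and
`validation/score/phasemap.py` 1.3 are; they agree on the verdict of every one of 86 400 synthetic maps, kit
j258740). This is the KERNEL REFERENCE for §4.5 and for the two guards the v1.3 rulings lean on in prose.

* §1 `verdict Tfloor cells bands` (§4.5 verbatim): over the H = 0 truth-column cells of a map, given as a list of
  (T, word) pairs, and the non-null column bands (lo, hi): **SC** if any cell is «SC» or any band has lo ≥ 0.1 K;
  **NOT** if every cell with T ≥ T_floor is «not» (and there is one) and no band has hi ≥ 0.1 K; else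
  **UNDETERMINED**. `kind v truthSC` = the confusion entry TP/TN/FP/FN/ABSTAIN against the truth class.
* §2 THEOREMS. (a) FP GUARD (`verdict_ne_SC_of_noSC`, `kind_ne_FP_of_noSC`): a map with no «SC» cell and no band
  lo ≥ 0.1 K is never verdict SC, hence never an FP — the syntactic condition (iv) of the §4.5b HONEST-FLAG and of
  PASS-TV3 is sufficient by itself. (b) HONEST ABSTENTION (`verdict_of_all_undetermined`): «undetermined»
  everywhere with no band ⇒ UNDETERMINED ⇒ `kind = ABSTAIN` (counted by the decided-fraction floor, never a
  TN/FP). (c) MONOTONICITY (`verdict_cons_SC`): one «SC» cell makes the verdict SC whatever else the map says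
  (the costliest error is one cell away). (d) `verdict_NOT_no_SC`: a NOT verdict certifies the absence of any SC
  cell. (e) LEVEL-4/LEVEL-2 LINK (`exists_disagree_of_verdict_NOT`): on a known superconductor (measured T_c, tolerance
  τ), a NOT verdict FORCES a cell-level disagreement at every relevant grid temperature below T_c − τ — an FN is
  never invisible in the cell accuracy (§4.3) provided the grid has a point in [T_floor, T_c − τ).
* §3 the three §14 worked-example SHAPES evaluated by the kernel: LK-99 today (all undetermined ⇒ ABSTAIN),
  Cu / La₂CuO₄ («not» above T_floor, no band ⇒ NOT ⇒ TN), MgB₂ (band lo 33 K ⇒ SC ⇒ TP), and the FP shape.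

Design: lists over `ℚ × Word` and `ℚ × ℚ`, Booleans as the scorers print them; the deciding confidence class and
the P-column bookkeeping are omitted (they select WHICH cells enter the lists, not the rule).
-/

namespace Summit.Ventures.CertifiedManyBodySolver.Downfold

namespace CellScore

/-! ## §1 The verdict (ACCEPTANCE §4.5) -/

/-- The three material verdicts of §4.5. [folklore] -/
inductive Verdict
  /-- the map calls the material a superconductor (some SC cell, or a band with lo ≥ 0.1 K) -/
  | SC
  /-- the map calls the material a non-superconductor on the measured range -/
  | NOT
  /-- the map does not decide -/
  | UNDETERMINED
  deriving DecidableEq, Repr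

/-- The confusion entry of a material (§4.5): TP, TN, FP, FN over decided materials; ABSTAIN otherwise. [folklore] -/
inductive Kind
  /-- verdict SC on a known superconductor -/
  | TP
  /-- verdict NOT on a known non-superconductor / retracted or unreplicated claim -/
  | TN
  /-- verdict SC on a non-superconductor or a claim — «the costliest error for a search oracle», always named -/
  | FP
  /-- verdict NOT on a known superconductor -/
  | FN
  /-- verdict UNDETERMINED -/
  | ABSTAIN
  deriving DecidableEq, Repr

/-- §4.5 «SC if any cell is SC or any column's band has lo ≥ 0.1 K». [folklore] -/
def saysSC (cells : List (ℚ × Word)) (bands : List (ℚ × ℚ)) : Bool :=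
  cells.any (fun c => decide (c.2 = Word.SC)) || bands.any (fun b => decide ((1 : ℚ) / 10 ≤ b.1))

/-- the cells at or above the floor temperature (`T_floor` = the truth's T_min_measured for non-superconductors,
0.1 K otherwise). [folklore] -/
def relevant (Tfloor : ℚ) (cells : List (ℚ × Word)) : List (ℚ × Word) :=
  cells.filter (fun c => decide (Tfloor ≤ c.1))

/-- §4.5 «NOT if every cell with T ≥ T_floor is not and no band with hi ≥ 0.1 K» (with at least one such cell).
[folklore] -/
def saysNOT (Tfloor : ℚ) (cells : List (ℚ × Word)) (bands : List (ℚ × ℚ)) : Bool :=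
  !(relevant Tfloor cells).isEmpty && (relevant Tfloor cells).all (fun c => decide (c.2 = Word.not))
    && !(bands.any (fun b => decide ((1 : ℚ) / 10 ≤ b.2)))

/-- ACCEPTANCE §4.5 material verdict. [folklore] -/
def verdict (Tfloor : ℚ) (cells : List (ℚ × Word)) (bands : List (ℚ × ℚ)) : Verdict :=
  if saysSC cells bands then .SC else if saysNOT Tfloor cells bands then .NOT else .UNDETERMINED

/-- §4.5 confusion entry; `isSC` = the truth class is `known-SC` (every other class counts as NOT). [folklore] -/
def kind : Verdict → Bool → Kind
  | .SC, true => .TP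
  | .SC, false => .FP
  | .NOT, true => .FN
  | .NOT, false => .TN
  | .UNDETERMINED, _ => .ABSTAIN

/-! ## §2 Property sheet -/

section props

variable {Tfloor : ℚ} {cells : List (ℚ × Word)} {bands : List (ℚ × ℚ)}

/-- `saysSC` unfolded. [folklore] -/
theorem saysSC_eq_true_iff :
    saysSC cells bands = true ↔ (∃ c ∈ cells, c.2 = Word.SC) ∨ (∃ b ∈ bands, (1 : ℚ) / 10 ≤ b.1) := by
  simp [saysSC, List.any_eq_true]

/-- The verdict is SC exactly when `saysSC`. [folklore] -/
theorem verdict_eq_SC_iff : verdict Tfloor cells bands = .SC ↔ saysSC cells bands = true := by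
  unfold verdict
  split_ifs with h1 h2 <;> simp [h1]

/-- FP GUARD (§4.5b (iv), PASS-TV3): no «SC» cell and no band with lo ≥ 0.1 K ⇒ the verdict is not SC. [folklore] -/
theorem verdict_ne_SC_of_noSC (hc : ∀ c ∈ cells, c.2 ≠ Word.SC) (hb : ∀ b ∈ bands, b.1 < (1 : ℚ) / 10) :
    verdict Tfloor cells bands ≠ .SC := by
  rw [Ne, verdict_eq_SC_iff, saysSC_eq_true_iff]
  rintro (⟨c, hcm, hcw⟩ | ⟨b, hbm, hbl⟩)
  · exact hc c hcm hcw
  · exact absurd hbl (not_le.mpr (hb b hbm))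

/-- … hence never an FP, whatever the truth class. [folklore] -/
theorem kind_ne_FP_of_noSC (hc : ∀ c ∈ cells, c.2 ≠ Word.SC) (hb : ∀ b ∈ bands, b.1 < (1 : ℚ) / 10)
    (isSC : Bool) : kind (verdict Tfloor cells bands) isSC ≠ .FP := by
  have h := verdict_ne_SC_of_noSC (Tfloor := Tfloor) hc hb
  revert h
  cases verdict Tfloor cells bands <;> cases isSC <;> simp [kind]

/-- An FP always comes from verdict SC (contrapositive bookkeeping of `kind`). [folklore] -/
theorem verdict_eq_SC_of_kind_FP {v : Verdict} {isSC : Bool} (h : kind v isSC = .FP) : v = .SC := by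
  revert h
  cases v <;> cases isSC <;> simp [kind]

/-- ABSTAIN ⇔ UNDETERMINED: the differentiation score counts decided materials only. [folklore] -/
theorem kind_eq_ABSTAIN_iff {v : Verdict} {isSC : Bool} : kind v isSC = .ABSTAIN ↔ v = .UNDETERMINED := by
  cases v <;> cases isSC <;> simp [kind]

/-- HONEST ABSTENTION: «undetermined» at every cell and no band ⇒ UNDETERMINED (today's honest shape of the
LSCO dome, LK-99, C–S–H: counted by the floors, never scored as a miss or a hit). [folklore] -/
theorem verdict_of_all_undetermined (h : ∀ c ∈ cells, c.2 = Word.undetermined) :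
    verdict Tfloor cells [] = .UNDETERMINED := by
  unfold verdict
  have h1 : saysSC cells [] = false := by
    rw [Bool.eq_false_iff, Ne, saysSC_eq_true_iff]
    rintro (⟨c, hcm, hcw⟩ | ⟨b, hbm, _⟩)
    · rw [h c hcm] at hcw
      exact Word.noConfusion hcw
    · simp at hbm
  have h2 : saysNOT Tfloor cells [] = false := by
    rw [Bool.eq_false_iff]
    intro hn
    simp only [saysNOT, Bool.and_eq_true, Bool.not_eq_true', List.all_eq_true, decide_eq_true_eq] at hn
    obtain ⟨⟨hne, hall⟩, -⟩ := hn
    cases hr : relevant Tfloor cells with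
    | nil => simp [hr] at hne
    | cons c tl =>
      have hc : c ∈ relevant Tfloor cells := by simp [hr]
      have hcw := hall c hc
      have hc' : c ∈ cells := (List.mem_filter.mp hc).1
      rw [h c hc'] at hcw
      exact Word.noConfusion hcw
  simp [h1, h2]

/-- MONOTONICITY: one «SC» cell decides SC regardless of the rest of the map. [folklore] -/
theorem verdict_cons_SC (T : ℚ) : verdict Tfloor ((T, Word.SC) :: cells) bands = .SC := by
  rw [verdict_eq_SC_iff, saysSC_eq_true_iff]
  exact Or.inl ⟨(T, Word.SC), by simp, rfl⟩

/-- A band with lo ≥ 0.1 K decides SC even with no SC cell (§4.5 / Q6 of the v1.2 rulings). [folklore] -/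
theorem verdict_cons_band {lo hi : ℚ} (h : (1 : ℚ) / 10 ≤ lo) : verdict Tfloor cells ((lo, hi) :: bands) = .SC := by
  rw [verdict_eq_SC_iff, saysSC_eq_true_iff]
  exact Or.inr ⟨(lo, hi), by simp, h⟩

/-- A NOT verdict certifies that no cell says SC. [folklore] -/
theorem verdict_NOT_no_SC (h : verdict Tfloor cells bands = .NOT) : ∀ c ∈ cells, c.2 ≠ Word.SC := by
  intro c hc hw
  have hsc : saysSC cells bands = true := saysSC_eq_true_iff.mpr (Or.inl ⟨c, hc, hw⟩)
  have := (verdict_eq_SC_iff (Tfloor := Tfloor)).mpr hsc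
  rw [h] at this
  exact Verdict.noConfusion this

/-- A NOT verdict says «not» at every relevant cell. [folklore] -/
theorem word_eq_not_of_verdict_NOT (h : verdict Tfloor cells bands = .NOT) {c : ℚ × Word} (hc : c ∈ cells)
    (hT : Tfloor ≤ c.1) : c.2 = Word.not := by
  unfold verdict at h
  split_ifs at h with h1 h2
  simp only [saysNOT, Bool.and_eq_true, Bool.not_eq_true', List.all_eq_true, decide_eq_true_eq] at h2
  exact h2.1.2 c (List.mem_filter.mpr ⟨hc, by simpa using hT⟩)

/-- LEVEL-4 ⇒ LEVEL-2 LINK: on a known superconductor (truth column SC with `Tc`, `τ`), a NOT verdict forces a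
cell DISAGREEMENT at every relevant grid temperature below `Tc − τ` — an FN is always visible in the §4.3 cell
accuracy too, provided the grid has a point in `[T_floor, Tc − τ)`. [folklore] -/
theorem disagree_of_verdict_NOT {Tc τ : ℚ} (h : verdict Tfloor cells bands = .NOT) {c : ℚ × Word} (hc : c ∈ cells)
    (hT : Tfloor ≤ c.1) (hlt : c.1 < Tc - τ) : outcome c.2 (truthSC Tc τ c.1) = .disagree := by
  rw [word_eq_not_of_verdict_NOT h hc hT, truthSC_of_lt hlt]
  rfl

/-- Corollary: such a map has at least one disagreeing cell. [folklore] -/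
theorem exists_disagree_of_verdict_NOT {Tc τ : ℚ} (h : verdict Tfloor cells bands = .NOT)
    (hgrid : ∃ c ∈ cells, Tfloor ≤ c.1 ∧ c.1 < Tc - τ) :
    ∃ c ∈ cells, outcome c.2 (truthSC Tc τ c.1) = .disagree := by
  obtain ⟨c, hc, hT, hlt⟩ := hgrid
  exact ⟨c, hc, disagree_of_verdict_NOT h hc hT hlt⟩

end props

/-! ## §3 The §14 worked-example shapes, evaluated -/

section cases
open Word

/-- constructor disequalities fed to `norm_num` in the examples below (closed terms; `decide`). [folklore] -/
theorem Word.undetermined_ne_SC : Word.undetermined ≠ Word.SC := by decide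
/-- see `Word.undetermined_ne_SC`. [folklore] -/
theorem Word.not_ne_SC : Word.not ≠ Word.SC := by decide
/-- see `Word.undetermined_ne_SC`. [folklore] -/
theorem Word.undetermined_ne_not : Word.undetermined ≠ Word.not := by decide

/-- LK-99 / C–S–H today: «undetermined» at every T, no band ⇒ UNDETERMINED ⇒ ABSTAIN (honest flag, §4.5b). -/
example : verdict (1 / 10) [(0, undetermined), (1 / 10, undetermined), (10, undetermined), (300, undetermined)] [] =
    .UNDETERMINED := by norm_num [verdict, saysSC, saysNOT, relevant, Word.undetermined_ne_SC, Word.not_ne_SC, Word.undetermined_ne_not]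
example : kind .UNDETERMINED false = .ABSTAIN := by decide
/-- Cu (T_min 10 μK) / La₂CuO₄ (T_min 4.2 K): «not» at every grid T ≥ T_floor, no band ⇒ NOT ⇒ TN. -/
example : verdict (42 / 10) [(0, undetermined), (4, undetermined), (6, Word.not), (300, Word.not)] [] = .NOT := by
  norm_num [verdict, saysSC, saysNOT, relevant, Word.undetermined_ne_SC, Word.not_ne_SC, Word.undetermined_ne_not]
example : kind .NOT false = .TN := by decide
/-- MgB₂-shape: band [33, 42] K (lo ≥ 0.1) ⇒ SC even with «undetermined» inside the band ⇒ TP on a known SC. -/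
example : verdict (1 / 10) [(0, SC), (30, SC), (40, undetermined), (50, Word.not)] [(33, 42)] = .SC := by
  norm_num [verdict, saysSC]
example : kind .SC true = .TP := by decide
/-- the FP shape §4.5 names: any SC cell on a non-superconductor / claim. -/
example : kind (verdict (1 / 10) [(0, SC), (300, Word.not)] []) false = .FP := by norm_num [verdict, saysSC, kind, Word.not_ne_SC]
/-- straddle / sub-floor bookkeeping: «not» only below T_floor decides nothing ⇒ UNDETERMINED. -/
example : verdict 2 [(0, undetermined), (1, Word.not), (4, undetermined)] [] = .UNDETERMINED := by
  norm_num [verdict, saysSC, saysNOT, relevant, Word.undetermined_ne_SC, Word.not_ne_SC, Word.undetermined_ne_not]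
/-- a band with hi ≥ 0.1 but lo < 0.1 blocks NOT without asserting SC ⇒ UNDETERMINED. -/
example : verdict (1 / 10) [(1, Word.not), (4, Word.not)] [(0, 3)] = .UNDETERMINED := by
  norm_num [verdict, saysSC, saysNOT, relevant, Word.undetermined_ne_SC, Word.not_ne_SC, Word.undetermined_ne_not]

end cases

end CellScore

end Summit.Ventures.CertifiedManyBodySolver.Downfold
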